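/-
Copyright: cell gate-hubbard-kl, typer seat t6 (D-0069 (2) B1 statement-typer wave). Statement-level skeleton of a
published text; nothing here is a claim about the Hubbard model or about superconductivity.
-/
import Mathlib
import Literature.MathematicalPhysics.QuantumLattice.MatsubaraSectorPropagator
import Literature.MathematicalPhysics.QuantumLattice.AnisotropicSectors
import HarnessLib

/-!
# Disertori–Rivasseau 2000, Part I — §II «Model and Notations», §III.3 «Sectors»: the two-dimensional jellium model at
temperature `T ≥ 0` with continuous cutoffs; Lemma 1 (antiperiodisation) and Lemma 2 (tadpoles vanish)

M. Disertori, V. Rivasseau, *Interacting Fermi liquid in two dimensions at finite temperature. Part I: Convergent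
Attributions*, Commun. Math. Phys. **215** (2000) 251–290, arXiv:cond-mat/9907130 [DisertoriRivasseau2000].
Held render: `paper:arxiv-cond-mat_9907130` (corpus TeX, 18 chunks; LOCATOR `pNNNN:Lm` = 3000-character chunk `pNNNN.txt`,
line `m` — NOT a printed page; equation labels are stripped by the render, so items are located by chunk/line and by the
numbered Lemma/Theorem).  Cell rows (HOME/DAG.tsv): DR1.L1 = F-039, DR1.L2 = F-040 (this file); the expansion/bounds rows
DR1.T1, DR1.T2, DR1.L3–L12 are in the companion `FermiRG/DR2000PartI.lean`.

HONEST FRAMING.  The source treats the ISOTROPIC JELLIUM model in the continuum `ℝ²` («the isotropic jellium model with a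
continuous rotation invariant ultraviolet cutoff», p0003:L3–5), dispersion `e(k⃗) = k⃗²/2m − μ` normalised to `2m = μ = 1`,
`e(k⃗) = k⃗² − 1` (p0003:L73–83).  It is NOT the Hubbard model and nothing here is transplanted to the lattice: no map to
the tree's `sqDispersion` exists or is claimed.  The relevance to the cell is methodological (continuous RG with
anisotropic sectors at `T > 0`; `[DR1, DR2]` are the finite-temperature Fermi-liquid class cited by FKT).

WHAT IS PRINTED (render, verbatim up to stripped macros).  p0003:L49–58 «the propagator at temperature T, C(x₀,x⃗), is
antiperiodic in the variable x₀ with antiperiod 1/T … k₀ = (2n+1)π/β, n ∈ ℤ, where β = 1/T».  p0003:L65 «kx := −k₀x₀ + k⃗x⃗».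
p0003:L73–86 «Ĉ_{ab}(k) = δ_{ab} 1/(ik₀ − e(k⃗)), e(k⃗) = k⃗²/2m − μ … we put 2m = μ = 1, so that e(k⃗) = k⃗² − 1. Hence
C_{ab}(x) = (1/((2π)²β)) Σ_{k₀} ∫d²k e^{ikx} Ĉ_{ab}(k)».  p0003:L97–99 «∫d³k ≡ (1/β)Σ_{k₀}∫d²k, ∫d³x ≡ ½∫_{−β}^{β}dx₀∫d²x».
**Lemma 1** p0003:L103–108 «The function C defined in (II.4) can also be written as C(x) = f(x₀,x⃗) :=
Σ_{m∈ℤ} (−1)^m C₀(x₀ + m/T, x⃗), where C₀ is the propagator at T = 0.» (proof: «f̂(k) = Ĉ(k) ∀k»).  p0003:L121 «S_V =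
(λ/2)∫_V d³x (Σ_a ψ̄_aψ_a)²» (no counterterm in Part I, L116–118).  p0004:L10–16 «C^{Λ₀}_Λ(k) := C(k)·[u(r/Λ₀²) − u(r/Λ²)]|
_{r = k₀²+e²(k⃗)} where we fixed Λ₀ = 1, 0 ≤ Λ ≤ 1 and the compact support function u ∈ C₀^∞(ℝ) satisfies: u(r) = 0 for
|r| > 1/2; u(r) = 1 for |r| < 1/4; ∫u(r)dr = 3/4», u chosen Gevrey (footnote L18–26: «∀n ≥ 0, ‖f^{(n)}‖_{L₁} ≤ A μ^{−n}
(n/e)^{ns}»).  p0004:L43–51 «C_α = 0 if 1/√(2α) < π/β, hence … C^{Λ₀}_Λ(k) = C(k)[u(r/Λ₀²) − u(r/Λ_T²)], Λ_T :=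
max[Λ, √2 πT]».  p0004:L147–148 «Λ²(u) = u(Λ₀² − Λ²) + Λ²; Λ(0) = Λ; Λ(1) = Λ₀».  p0005:L70–76 (II.24) «C^{w_q}(k) =
∂_{w_q}∫ dα C_α(k) = (Λ₀²−Λ²)/Λ⁴(w_q) [ik₀ + e(k⃗)] u'((k₀²+e²(k⃗))/Λ²(w_q))».  p0005:L105–108 «u^j(k) := [u[rΛ^{−2}(w_j)] −
u[rΛ^{−2}(w_{j−1})]]|_{r = k₀²+e²(k⃗)}» (the cutoff of the j-th band).  **Lemma 2** p0006:L42–44 «The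
amplitude of a tadpole with loop line in some band i is zero ∀i.» with proof p0006:L47–72: the loop integral
(1/(2π)²)∫d³k C^{Λ(w_i)}_{Λ(w_{i−1})}(k) = −(1/((2π)²β))Σ_{k₀}∫d²k (ik₀+e)/(k₀²+e²)·U, U = u((k₀²+e²)/Λ²(w_i)) −
u((k₀²+e²)/Λ²(w_{i−1})); the ik₀ term is odd in k₀; with t = |k⃗|² − 1 the rest is π∫_{−1}^{1}dt t/(k₀²+t²) U(k₀²,t²) = 0
by parity («the domain of t can be reduced to [−1,1] since, for t ≥ 1, k₀²+t² ≥ 1 > Λ²(w_i)/2, hence U = 0»).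
§III.3.1 p0009:L57–78: sectors «(4/3)α_s^{1/4}∫₀^{2π}dθ_s χ^θ_{α_s}(θ_s) = 1», «χ^θ_{α_s}(θ_s) := u_p^{α_s}[α_s^{1/4}(θ − θ_s)],
where u_p^{α_s} is the periodic function of period τ = 2πα_s^{1/4} obtained from u», «A sector is defined as a couple
(α_s, θ_s) … Inside this support |θ − θ_s| ≤ ½ α_s^{−1/4}».

WHAT IS TYPED, AND HOW.  Momenta/positions are `Mom = ℝ × (Fin 2 → ℝ)` = `(k₀, k⃗)` as in the tree's sector-propagator
files; the Matsubara frequencies are the tree's `fermiMatsubara β m = π(2m+1)/β` (module `MatsubaraSectorPropagator`,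
CITED not re-declared) at `β = 1/T`; the polar angle of `k⃗` is the tree's `polarAngle`.  `dispersion`, `freeSymbol`,
`rOf` (= r = k₀²+e²), the cutoff axioms `IsCutoff` (II.13) and the Gevrey class `IsGevreyL1` (footnote) are explicit
definitions/predicates; `cutoffSymbol` (II.12), `scaleAt` = Λ(w) (II.22), `lambdaT` (II.19), `bandCutoff` = u^j (II.26),
`treeLineSymbol` = C^{w_q} (II.24), the position-space kernels `thermalKernel` ((II.4) with (II.7): prefactor T/(2π)²
and the Matsubara sum) and `zeroKernel` (the T = 0 propagator, prefactor 1/(2π)³), and the sector cutoff `sectorChi`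
((III.10)–(III.11), the periodisation written as the sum over translates — equal to the printed piecewise definition
because τ = 2πα_s^{1/4} ≥ 1 when α_s ≥ (2π)^{−4}, in particular for all sectors of the paper, α_s ≥ 1).
* **Lemma 1** is the named fact `Lemma1Antiperiodisation` stated for every smooth compactly supported symbol `a(k₀,k⃗)`:
  this is exactly what the printed one-line proof («f̂ = Ĉ», Poisson summation in k₀) establishes and how §IV uses it
  (for η_θ in Lemma 5 and for C^{w_q} in (IV.21): «applying (II.9)»); the literal object of the printed sentence, the
  propagator WITHOUT cutoffs, is a conditionally convergent oscillatory integral and is not typed (DIVERGENCE (i)).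
* **Lemma 2** is the named fact `Lemma2TadpoleVanishes`: for every cutoff `u` with (II.13), every band
  `0 < Λ_lo ≤ Λ_hi ≤ 1 = Λ₀` and every `T > 0`, the band-restricted loop integral at coinciding points vanishes, together
  with its `T = 0` form (the paper's `∫d³k` convention (II.7) covers both).
Nothing is asserted: both lemmas are `def … : Prop` named facts (D-0014) awaiting `_holds` proofs.

LOCATOR ERRATUM (rev 2): the first landing (p414023) printed some chunk:line locators with the line offset of a
concatenated two-chunk view (p0006 lines +141, p0009 lines +112); corrected here, statements unchanged.

DIVERGENCES / NOT TYPED.  (i) Lemma 1 typed for `C_c^∞` symbols (covers (II.12), (II.24), (IV.19)); the bare (II.4) is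
not a Lebesgue integral.  (ii) `u (r / Λ^2)` at `Λ = 0` is Lean's `u 0 = 1`, not the intended `0`: every statement keeps
`Λ > 0` (the paper takes `Λ → 0` as a limit, and at `T > 0` the effective cutoff is `Λ_T ≥ √2πT > 0`).  (iii) The measure
in (II.16) «C^{Λ₀}_Λ = ∫_{Λ₀^{−2}}^{Λ^{−2}} dα C_α» vs (II.17) «C_α = C η[αr], η(r) = −r u'(r)» is consistent with (II.12) and
(II.24) only as `dα/α` (render-inferred); only the unambiguous (II.24) and (II.26) are typed.  (iv) The Gevrey Fourier
bound (II.15) and the spin structure `δ_{ab}` are docstring-level (spin is a factor `δ_{ab}`; all typed kernels are the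
scalar part).  (v) The interaction (II.10) and the vertex functions (II.8) are typed abstractly in the companion file.
-/

noncomputable section

open MeasureTheory Complex Filter
open scoped Topology BigOperators

namespace Literature.MathematicalPhysics.QuantumLattice.FermiRG.DR2000

open Literature.MathematicalPhysics.QuantumLattice

/-! ## §II.1 The model: three-momenta, dispersion, free propagator (p0003) -/

/-- Three-vectors `k = (k₀, k⃗)` / `x = (x₀, x⃗)`: one (imaginary-)time component and a planar one («there are really three
dimensions», p0003:L77–79). [cite: DisertoriRivasseau2000, §II.1 p0003:L61–63] -/
abbrev Mom : Type := ℝ × (Fin 2 → ℝ)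

/-- The pairing `kx := −k₀x₀ + k⃗·x⃗`. [cite: DisertoriRivasseau2000, §II.1 (II.5) p0003:L64–65] -/
def pairing (k x : Mom) : ℝ := -(k.1 * x.1) + (k.2 0 * x.2 0 + k.2 1 * x.2 1)

/-- The jellium dispersion with `2m = μ = 1`: `e(k⃗) = k⃗² − 1` (Fermi surface = the unit circle).
[cite: DisertoriRivasseau2000, §II.1 (II.3) p0003:L73–83] -/
def dispersion (k : Fin 2 → ℝ) : ℝ := k 0 ^ 2 + k 1 ^ 2 - 1

/-- The free propagator symbol `Ĉ(k) = 1/(ik₀ − e(k⃗))` (scalar part; the spin structure is `δ_{ab}`).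
[cite: DisertoriRivasseau2000, §II.1 (II.2) p0003:L73] -/
def freeSymbol (k : Mom) : ℂ := 1 / (Complex.I * (k.1 : ℂ) - (dispersion k.2 : ℂ))

/-- `r = k₀² + e²(k⃗)`, the argument of every cutoff. [cite: DisertoriRivasseau2000, §II.2 (II.12) p0004:L10–11] -/
def rOf (k : Mom) : ℝ := k.1 ^ 2 + dispersion k.2 ^ 2

/-- The Matsubara three-momentum `((2n+1)πT, k⃗)` at temperature `T` — the tree's `fermiMatsubara β n` at `β = 1/T`.
[cite: DisertoriRivasseau2000, §II.1 (II.1) p0003:L57–58] -/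
def matsubaraMom (T : ℝ) (n : ℤ) (k : Fin 2 → ℝ) : Mom := (fermiMatsubara (1 / T) n, k)

/-- `fermiMatsubara (1/T) n = (2n+1)πT`. [cite: DisertoriRivasseau2000, §II.1 (II.1) p0003:L57] -/
theorem matsubaraMom_fst (T : ℝ) (n : ℤ) (k : Fin 2 → ℝ) :
    (matsubaraMom T n k).1 = (2 * (n : ℝ) + 1) * Real.pi * T := by
  simp only [matsubaraMom, fermiMatsubara, one_div, div_inv_eq_mul]
  ring

/-- The position-space kernel at temperature `T > 0` of a momentum symbol `a`:
`(T/(2π)²) Σ_{n∈ℤ} ∫d²k e^{ikx} a((2n+1)πT, k⃗)` — (II.4) with the convention (II.7) `∫d³k ≡ (1/β)Σ_{k₀}∫d²k`.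
[cite: DisertoriRivasseau2000, §II.1 (II.4), (II.7) p0003:L85–99] -/
def thermalKernel (T : ℝ) (a : Mom → ℂ) (x : Mom) : ℂ :=
  ((T / (2 * Real.pi) ^ 2 : ℝ) : ℂ) *
    ∑' n : ℤ, ∫ k : Fin 2 → ℝ, Complex.exp ((pairing (matsubaraMom T n k) x : ℂ) * Complex.I) * a (matsubaraMom T n k)

/-- The `T = 0` kernel of a symbol `a`: `(1/(2π)³) ∫d³k e^{ikx} a(k)` («when T → 0 … the corresponding discrete sum
becomes an integral»). [cite: DisertoriRivasseau2000, §II.1 (II.6) p0003:L90–95] -/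
def zeroKernel (a : Mom → ℂ) (x : Mom) : ℂ :=
  ((1 / (2 * Real.pi) ^ 3 : ℝ) : ℂ) * ∫ k : Mom, Complex.exp ((pairing k x : ℂ) * Complex.I) * a k

/-! ## §II.2 Cutoffs (p0004–p0005) -/

/-- The cutoff function of (II.13): `u ∈ C₀^∞(ℝ)`, `u(r) = 0` for `|r| > 1/2`, `u(r) = 1` for `|r| < 1/4`, `∫u = 3/4`.
[cite: DisertoriRivasseau2000, §II.2 (II.13) p0004:L12–16] -/
structure IsCutoff (u : ℝ → ℝ) : Prop where
  smooth : ContDiff ℝ ((⊤ : ℕ∞) : WithTop ℕ∞) u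
  eq_zero : ∀ r : ℝ, 1 / 2 < |r| → u r = 0
  eq_one : ∀ r : ℝ, |r| < 1 / 4 → u r = 1
  integral_eq : ∫ r : ℝ, u r = 3 / 4

/-- The Gevrey class of order `s` in the `L₁` form of the footnote to (II.13): constants `A, μ` with
`‖f^{(n)}‖_{L₁} ≤ A μ^{−n} (n/e)^{ns}` for all `n ≥ 0`. [cite: DisertoriRivasseau2000, §II.2 (II.14) p0004:L18–22] -/
def IsGevreyL1 (s A μ : ℝ) (f : ℝ → ℝ) : Prop :=
  0 < A ∧ 0 < μ ∧ ∀ n : ℕ, ∫ r : ℝ, |iteratedDeriv n f r| ≤ A * μ ^ (-(n : ℤ)) * ((n : ℝ) / Real.exp 1) ^ ((n : ℝ) * s)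

/-- The propagator with both cutoffs, `C^{Λ₀}_Λ(k) = C(k)·[u(r/Λ₀²) − u(r/Λ²)]`, `r = k₀² + e²(k⃗)` (use with `Λ > 0`;
at `T > 0` the paper replaces `Λ` by `Λ_T`, (II.18)). [cite: DisertoriRivasseau2000, §II.2 (II.12) p0004:L10–11] -/
def cutoffSymbol (u : ℝ → ℝ) (Λ Λ₀ : ℝ) (k : Mom) : ℂ :=
  freeSymbol k * ((u (rOf k / Λ₀ ^ 2) - u (rOf k / Λ ^ 2) : ℝ) : ℂ)

/-- `Λ_T := max[Λ, √2 πT]` — «the temperature cut-off implies that C_α = 0 if 1/√(2α) < π/β».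
[cite: DisertoriRivasseau2000, §II.2 (II.19) p0004:L43–51] -/
def lambdaT (Λ T : ℝ) : ℝ := max Λ (Real.sqrt 2 * Real.pi * T)

/-- The interpolated scale `Λ(w)`, `Λ²(w) = w(Λ₀² − Λ²) + Λ²`, `Λ(0) = Λ`, `Λ(1) = Λ₀`.
[cite: DisertoriRivasseau2000, §II.3 (II.22) p0004:L146–148] -/
def scaleAt (Λ Λ₀ w : ℝ) : ℝ := Real.sqrt (w * (Λ₀ ^ 2 - Λ ^ 2) + Λ ^ 2)

/-- `Λ(0) = Λ` for `Λ ≥ 0`. [cite: DisertoriRivasseau2000, §II.3 (II.22) p0004:L148] -/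
theorem scaleAt_zero {Λ : ℝ} (hΛ : 0 ≤ Λ) (Λ₀ : ℝ) : scaleAt Λ Λ₀ 0 = Λ := by
  simp [scaleAt, Real.sqrt_sq hΛ]

/-- `Λ(1) = Λ₀` for `Λ₀ ≥ 0`. [cite: DisertoriRivasseau2000, §II.3 (II.22) p0004:L148] -/
theorem scaleAt_one (Λ : ℝ) {Λ₀ : ℝ} (hΛ₀ : 0 ≤ Λ₀) : scaleAt Λ Λ₀ 1 = Λ₀ := by
  simp [scaleAt, Real.sqrt_sq hΛ₀]

/-- `w_T`, defined by `Λ(w_T) = Λ_T` («w_T = 0 if Λ_T = Λ, i.e. if Λ ≥ √2πT»): explicitly `(Λ_T² − Λ²)/(Λ₀² − Λ²)`; at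
`Λ₀ = 1`, `Λ → 0` this is `Λ_T² = 2π²T²` («Λ(w) = √w as Λ₀ = 1», p0014:L123).
[cite: DisertoriRivasseau2000, §II.3 p0005:L9–12] -/
def wT (Λ Λ₀ T : ℝ) : ℝ := (lambdaT Λ T ^ 2 - Λ ^ 2) / (Λ₀ ^ 2 - Λ ^ 2)

/-- The band cutoff `u^j(k) = u[rΛ^{−2}(w_j)] − u[rΛ^{−2}(w_{j−1})]` of the band between the scales `Λ_lo = Λ(w_{j−1})`
and `Λ_hi = Λ(w_j)`, as a function of `r`. [cite: DisertoriRivasseau2000, §II.4.2 (II.26) p0005:L105–108] -/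
def bandCutoff (u : ℝ → ℝ) (Λlo Λhi r : ℝ) : ℝ := u (r / Λhi ^ 2) - u (r / Λlo ^ 2)

/-- The loop propagator restricted to one band, `C(k) u^j(k)` ((II.25): `C^{Λ(w_j)}_{Λ(w_{j−1})}` in the notation of
Lemma 2). [cite: DisertoriRivasseau2000, §II.4.2 (II.25) p0005:L98–101] -/
def bandSymbol (u : ℝ → ℝ) (Λlo Λhi : ℝ) (k : Mom) : ℂ := freeSymbol k * (bandCutoff u Λlo Λhi (rOf k) : ℂ)

/-- The tree-line propagator of the q-th band in momentum space,
`C^{w_q}(k) = (Λ₀² − Λ²)/Λ⁴(w_q) · [ik₀ + e(k⃗)] · u'((k₀² + e²(k⃗))/Λ²(w_q))`, as a function of the scale `Λw = Λ(w_q)`.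
[cite: DisertoriRivasseau2000, §II.4.1 (II.24) p0005:L70–76] -/
def treeLineSymbol (u : ℝ → ℝ) (Λ Λ₀ Λw : ℝ) (k : Mom) : ℂ :=
  (((Λ₀ ^ 2 - Λ ^ 2) / Λw ^ 4 * deriv u (rOf k / Λw ^ 2) : ℝ) : ℂ) * (Complex.I * (k.1 : ℂ) + (dispersion k.2 : ℂ))

/-! ## §III.3.1 Sector cutoffs (p0009) -/

/-- The periodisation `u_p` of period `τ` of a function supported in `[−1/2, 1/2]`, written as the sum over translates;
for `τ ≥ 1` this is the printed «u_p(y) = u(x) when y = x + nτ for some x ∈ [−1/2,1/2[, n ∈ ℤ, and 0 otherwise».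
[cite: DisertoriRivasseau2000, §III.3.1 p0009:L66–70] -/
def periodise (u : ℝ → ℝ) (τ y : ℝ) : ℝ := ∑' n : ℤ, u (y - n * τ)

/-- The sector cutoff `χ^θ_{α_s}(θ_s) := u_p^{α_s}[α_s^{1/4}(θ − θ_s)]` of the sector `(α_s, θ_s)` (period
`τ = 2πα_s^{1/4}` in the rescaled variable), symmetric in `(θ, θ_s)`. [cite: DisertoriRivasseau2000, §III.3.1 (III.10)–(III.11) p0009:L57–71] -/
def sectorChi (u : ℝ → ℝ) (αs θs θ : ℝ) : ℝ :=
  periodise u (2 * Real.pi * αs ^ (1 / 4 : ℝ)) (αs ^ (1 / 4 : ℝ) * (θ - θs))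

/-- The sector cutoff evaluated on a planar momentum through its polar angle (the tree's `polarAngle`), as inserted in
(III.7)–(III.8). [cite: DisertoriRivasseau2000, §III.3.1 (III.7)–(III.10) p0009:L36–65] -/
def sectorChiMom (u : ℝ → ℝ) (αs θs : ℝ) (k : Fin 2 → ℝ) : ℝ := sectorChi u αs θs (polarAngle k)

/-- The angular support of the sector `(α_s, θ_s)`: «Inside this support |θ − θ_s| ≤ ½ α_s^{−1/4}» (modulo 2π).
[cite: DisertoriRivasseau2000, §III.3.1 p0009:L73–78] -/
def sectorSupport (αs θs : ℝ) : Set ℝ := {θ : ℝ | ∃ n : ℤ, |θ - θs - 2 * Real.pi * n| ≤ (1 / 2) * αs ^ (-(1 / 4 : ℝ))}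

/-! ## Lemma 1 — the finite-temperature propagator is the antiperiodisation of the `T = 0` one (row DR1.L1, F-039) -/

/-- **Lemma 1** (p0003:L103–108), typed for smooth compactly supported symbols (see the module docstring, «WHAT IS
TYPED» and DIVERGENCE (i)): for every `a ∈ C_c^∞(ℝ × ℝ²)`, every `T > 0` and every `x = (x₀, x⃗)`,
`(T/(2π)²) Σ_n ∫d²k e^{ikx} a((2n+1)πT, k⃗) = Σ_{m∈ℤ} (−1)^m C₀[a](x₀ + m/T, x⃗)` with `C₀[a] = (2π)^{−3}∫d³k e^{ikx}a(k)`
— «C(x) = Σ_{m∈ℤ} (−1)^m C₀(x₀ + m/T, x⃗) where C₀ is the propagator at T = 0».  Named fact, not asserted.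
[cite: DisertoriRivasseau2000, §II.1 Lemma 1 (II.9) p0003:L103–114] -/
def Lemma1Antiperiodisation : Prop :=
  ∀ (a : Mom → ℂ), ContDiff ℝ ((⊤ : ℕ∞) : WithTop ℕ∞) a → HasCompactSupport a →
    ∀ (T : ℝ), 0 < T → ∀ x : Mom,
      thermalKernel T a x = ∑' m : ℤ, (-1 : ℂ) ^ m * zeroKernel a (x.1 + (m : ℝ) / T, x.2)

/-! ## Lemma 2 — tadpoles vanish in every band (row DR1.L2, F-040; DECOMP E.2) -/

/-- **Lemma 2** (p0006:L42–72): «The amplitude of a tadpole with loop line in some band i is zero ∀i» —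
the loop integral `(1/(2π)²)∫d³k C^{Λ(w_i)}_{Λ(w_{i−1})}(k)` at coinciding points vanishes, for every cutoff `u` with
(II.13), every band `0 < Λ_lo ≤ Λ_hi ≤ Λ₀ = 1` and every temperature `T > 0` (Matsubara form, (II.7)), and in the `T = 0`
form.  Mechanism (printed proof): the `ik₀` part is odd in `k₀`; with `t = |k⃗|² − 1` the rest is
`π∫_{−1}^{1} dt t/(k₀²+t²) U(k₀²,t²) = 0` by parity, the support of `U` keeping `k₀² + t² ≤ Λ_hi²/2 < 1`.  Exact with these
cutoffs («Tadpoles are exactly zero because we choose our ultraviolet cutoff small enough», footnote p0006:L36–39).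
Named fact, not asserted. [cite: DisertoriRivasseau2000, §II.4.2 Lemma 2 p0006:L42] -/
def Lemma2TadpoleVanishes : Prop :=
  ∀ (u : ℝ → ℝ), IsCutoff u → ∀ (Λlo Λhi : ℝ), 0 < Λlo → Λlo ≤ Λhi → Λhi ≤ 1 →
    (∀ T : ℝ, 0 < T → thermalKernel T (bandSymbol u Λlo Λhi) 0 = 0) ∧ zeroKernel (bandSymbol u Λlo Λhi) 0 = 0

end Literature.MathematicalPhysics.QuantumLattice.FermiRG.DR2000

end
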